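import Mathlib
import Summits.NavierStokesRegularity.NavierStokesRegularity.Theorems.TypeIQuarterGateScarEnvelopeTypeISatelliteTowerClosure
import Summits.NavierStokesRegularity.NavierStokesRegularity.Theorems.TypeIQuarterGateScarEnvelopeTypeISatelliteTowerRooted

/-!
# Gallery compactness of the A–B class (free centres, free scales; ONE factor 4)

For an A–B object `(U, P, H)` of rate `M` (`ABTower M U P H`, the engine class of the 23843
zoom dictionary) and ANY sequence of final-time centres `x k : ℝ³` and scales `l k > 0`, the zooms
`zoom U (x k) 0 (l k)` have a subsequence converging in `L³(Q_R(0))` for EVERY `R > 0` to an A–B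
object `(U', P', H')` of the same rate with `𝐈(U') ≤ 4 · 𝐈(U)`; moreover final-time points at which
the zooms are frequently singular stay singular in the limit (persistence, A–B Prop. 2.3), and a
full-sequence `L³_loc` limit lying in `L³_loc` is a.e. the A–B representative.

This is the tree's closure theorem `abTower_closed` (tangent flows at ONE fixed centre along NULL
scales; nsreg-p3 Part K8, landed p639955) run with MOVING centres and arbitrary positive scales: the
«gallery» (Furstenberg) of one A–B object is precompact in `L³_loc` of the closed past and its
closure stays in the class with a single factor `4` on `𝐈` — the compactness input of the crux idea
`Cruxes/ScarEnvelopeTypeI/Ideas/zoom-recurrence.md` (ns-idea-17 g0; its rung (L2) `GalleryClosedAB`,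
here with the measurability / `MemLp` clause on the limit that the card's text omits), and the
gallery-wise reading of the instrument obstacle (M𝐈₁) of nsreg-p3 ROUND-35/37.

Proof = the landed proof of `abTower_closed` verbatim with the base point `z₀ = (0, y')` replaced by
`z k = (0, x k)`: the zoomed triples are in A–B's class on every `Q(0, 2ᵐ)` (the class on all balls
is translation-invariant, `𝐈` over the open lower half-space is scale- and translation-invariant),
the tree compactness theorem `SliceBudget.local_typeI_compactness_twin_inBall`, the rate passed to
the limit a.e., the two representative theorems and KNSS mildness; persistence is the last clause of
the compactness theorem read in `RegPt` currency.

HONEST FRAMING: compactness TOOLING about hypothetical Type-I zoom limits, by name, for the crux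
`TypeIQuarterGate.ScarEnvelopeTypeI` (item 23843) — nothing open is proved: 23843, the exclusions
`∀ M, ¬ OneScarLeaf M` / `∀ M, ¬ InfiniteDescent M`, the route and Navier–Stokes regularity are OPEN.
LEAD-lineage prover ns-sz-p1 g6; `--supports stmt-NavierStokesRegularity-23843 --as helper`.
-/

-- the summit-side namespace repeats a component by design (single-conjunct summit, D-0017)
set_option linter.dupNamespace false

open MeasureTheory Set Metric Filter Topology
open scoped ENNReal

namespace Summit.NavierStokesRegularity.NavierStokesRegularity.Cruxes.ScarEnvelopeTypeI.ZoomDictionary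

section Gallery

open Literature.Analysis.FluidPDE
variable {U : ℝ → (EuclideanSpace ℝ (Fin 3)) → (EuclideanSpace ℝ (Fin 3))} {P : ℝ → (EuclideanSpace ℝ (Fin 3)) → ℝ}

/-- Zooms about a final-time point `(0, x)`, at any scale `l > 0`, of a pair in A–B's class on
all balls are in the class on every ball `Q_a(0)` (the class on all balls is invariant under the
gallery maps). -/
theorem inBall_zoom_of_inBall
    (h : ∀ a : ℝ, 0 < a → IsSuitableWeakSolutionInBall a (0 : ℝ × (EuclideanSpace ℝ (Fin 3))) U P)
    (x : (EuclideanSpace ℝ (Fin 3))) {l : ℝ} (hl : 0 < l) {a : ℝ} (ha : 0 < a) :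
    IsSuitableWeakSolutionInBall a (0 : ℝ × (EuclideanSpace ℝ (Fin 3))) (zoom U x 0 l) (zoomP P x 0 l) := by
  have hρ0 : 0 < a * l := mul_pos ha hl
  have hsub : parabolicCylinder (a * l) (((0 : ℝ), x) : ℝ × (EuclideanSpace ℝ (Fin 3))) ⊆
      parabolicCylinder (‖x‖ + a * l) (0 : ℝ × (EuclideanSpace ℝ (Fin 3))) :=
    parabolicCylinder_subset_zero (pow_le_pow_left₀ hρ0.le (by linarith [norm_nonneg x]) 2) le_rfl
  have h0 : IsSuitableWeakSolutionInBall (a * l) (((0 : ℝ), x) : ℝ × (EuclideanSpace ℝ (Fin 3))) U P :=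
    (h (‖x‖ + a * l) (by positivity)).of_subset_zero (z := ((0 : ℝ), x)) hρ0 hsub
  have h1 := h0.zoom hρ0
  have hc0 : 0 < l / (a * l) := div_pos hl hρ0
  have h2 := h1.zoomOut hc0
  have hcρ : l / (a * l) * (a * l) = l := div_mul_cancel₀ _ hρ0.ne'
  have hrad : 1 / (l / (a * l)) = a := by
    rw [one_div_div, mul_div_cancel_right₀ _ hl.ne']
  rw [zoom_zoom, zoom_zoom, hcρ, hrad,
    show (l / (a * l)) ^ 2 * (a * l) ^ 2 = l ^ 2 by rw [← mul_pow, hcρ]] at h2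
  rw [zoom_eq_smul_stPull, zoomP_eq_smul_stPull]
  exact h2

/-- Zooms of an A–B velocity field are a.e.-strongly measurable on every `Q_R(0)`. -/
theorem aestronglyMeasurable_zoom_of_inBall
    (h : ∀ a : ℝ, 0 < a → IsSuitableWeakSolutionInBall a (0 : ℝ × (EuclideanSpace ℝ (Fin 3))) U P)
    (x : (EuclideanSpace ℝ (Fin 3))) {l : ℝ} (hl : 0 < l) {R : ℝ} (hR : 0 < R) :
    AEStronglyMeasurable (Function.uncurry (zoom U x 0 l))
      (volume.restrict (parabolicCylinder R (0 : ℝ × (EuclideanSpace ℝ (Fin 3))))) :=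
  (inBall_zoom_of_inBall h x hl hR).1.distributional.1.aestronglyMeasurable

/-- A field that is NOT regular at the final-time point `(0, y)` has infinite `L^∞` norm on every
backward cylinder `Q_R(0, y)`. -/
theorem eLpNorm_top_eq_top_of_not_regPt {W : ℝ → (EuclideanSpace ℝ (Fin 3)) → (EuclideanSpace ℝ (Fin 3))}
    {y : (EuclideanSpace ℝ (Fin 3))} (h : ¬ RegPt W y) {R : ℝ} (hR : 0 < R) :
    eLpNorm (Function.uncurry W) ⊤
      (volume.restrict (parabolicCylinder R (((0 : ℝ), y) : ℝ × (EuclideanSpace ℝ (Fin 3))))) = ⊤ := by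
  by_contra hne
  apply h
  refine ⟨R, hR, (eLpNorm (Function.uncurry W) ⊤
      (volume.restrict (parabolicCylinder R (((0 : ℝ), y) : ℝ × (EuclideanSpace ℝ (Fin 3)))))).toReal, ?_⟩
  have hae : ∀ᵐ z ∂(volume.restrict (parabolicCylinder R (((0 : ℝ), y) : ℝ × (EuclideanSpace ℝ (Fin 3))))),
      ‖Function.uncurry W z‖ₑ ≤ eLpNorm (Function.uncurry W) ⊤
        (volume.restrict (parabolicCylinder R (((0 : ℝ), y) : ℝ × (EuclideanSpace ℝ (Fin 3))))) := by
    rw [eLpNorm_exponent_top]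
    exact ae_le_eLpNormEssSup
  filter_upwards [hae] with z hz
  have h1 := ENNReal.toReal_mono hne hz
  rwa [toReal_enorm] at h1

/-- **Gallery compactness of the A–B class** (free centres, free positive scales, ONE factor 4).
For `(U, P, H)` in the engine class with rate `M`, any centres `x k` and any scales `l k > 0`:
along a subsequence `σ` the zooms `zoom U (x (σ j)) 0 (l (σ j))` converge in `L³(Q_R(0))` for
every `R > 0` to an A–B object `(U', P', H')` of rate `M` with `𝐈(U') ≤ 4·𝐈(U)` and
`U' ∈ L³(Q_R(0))`; and a final-time point at which the zooms along `σ` are frequently singular is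
a singular point of `U'` (persistence). -/
theorem abTower_galleryCompact {M : ℝ}
    {H : ℝ → (EuclideanSpace ℝ (Fin 3)) → (EuclideanSpace ℝ (Fin 3)) →L[ℝ] (EuclideanSpace ℝ (Fin 3))}
    (h : ABTower M U P H) (x : ℕ → (EuclideanSpace ℝ (Fin 3))) {l : ℕ → ℝ} (hl : ∀ k, 0 < l k) :
    ∃ (U' : ℝ → (EuclideanSpace ℝ (Fin 3)) → (EuclideanSpace ℝ (Fin 3))) (P' : ℝ → (EuclideanSpace ℝ (Fin 3)) → ℝ)
      (H' : ℝ → (EuclideanSpace ℝ (Fin 3)) → (EuclideanSpace ℝ (Fin 3)) →L[ℝ] (EuclideanSpace ℝ (Fin 3)))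
      (σ : ℕ → ℕ), StrictMono σ ∧ ABTower M U' P' H' ∧
      typeIBound (Iio (0 : ℝ) ×ˢ univ) U' P' H' ≤ 4 * typeIBound (Iio (0 : ℝ) ×ˢ univ) U P H ∧
      (∀ R : ℝ, 0 < R → MemLp (Function.uncurry U') 3
        (volume.restrict (parabolicCylinder R (0 : ℝ × (EuclideanSpace ℝ (Fin 3)))))) ∧
      (∀ R : ℝ, 0 < R → Tendsto (fun j => eLpNorm
        (Function.uncurry (zoom U (x (σ j)) 0 (l (σ j))) - Function.uncurry U') 3
        (volume.restrict (parabolicCylinder R (0 : ℝ × (EuclideanSpace ℝ (Fin 3)))))) atTop (𝓝 0)) ∧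
      (∀ y : (EuclideanSpace ℝ (Fin 3)),
        (∃ᶠ j in atTop, ¬ RegPt (zoom U (x (σ j)) 0 (l (σ j))) y) → ¬ RegPt U' y) := by
  obtain ⟨hmild, hIB, hH, hI⟩ := h
  have hdec : HasTypeITimeDecay M U := hmild.2.2.2
  have hM : 0 ≤ M := by
    have h := hdec (-1) (by norm_num) 0
    rw [neg_neg, Real.sqrt_one, div_one] at h
    exact (norm_nonneg _).trans h
  have hcc_pos : ∀ m : ℕ, (0 : ℝ) < (2 : ℝ) ^ m := fun m => by positivity
  set I₀ : ℝ≥0∞ := typeIBound (Iio (0 : ℝ) ×ˢ univ) U P H with hI₀def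
  -- the moving base points
  set z : ℕ → ℝ × (EuclideanSpace ℝ (Fin 3)) := fun k => ((0 : ℝ), x k) with hzdef
  have hz1 : ∀ k, (z k).1 = 0 := fun k => by rw [hzdef]
  have hz2 : ∀ k, (z k).2 = x k := fun k => by rw [hzdef]
  have hzsub : ∀ (k : ℕ) (ρ : ℝ), parabolicCylinder ρ (z k) ⊆ Iio (0 : ℝ) ×ˢ (univ : Set (EuclideanSpace ℝ (Fin 3))) :=
    fun k ρ => parabolicCylinder_subset_lowerHalf ρ (x k)
  have hQsl : ∀ (k : ℕ) (ρ : ℝ), (parabolicCylinderOpens ρ (z k) : TopologicalSpace.Opens (ℝ × (EuclideanSpace ℝ (Fin 3)))) ≤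
      slab (EuclideanSpace ℝ (Fin 3)) (Iio 0) isOpen_Iio := fun k ρ w hw => hzsub k ρ hw
  -- ## the zoomed triples
  set v : ℕ → ℝ → (EuclideanSpace ℝ (Fin 3)) → (EuclideanSpace ℝ (Fin 3)) :=
    fun k => l k • stPull (l k ^ 2) (l k) (z k).1 (z k).2 U with hvdef
  set q : ℕ → ℝ → (EuclideanSpace ℝ (Fin 3)) → ℝ := fun k => l k ^ 2 • stPull (l k ^ 2) (l k) (z k).1 (z k).2 P with hqdef
  set Gz : ℕ → ℝ → (EuclideanSpace ℝ (Fin 3)) → (EuclideanSpace ℝ (Fin 3)) →L[ℝ] (EuclideanSpace ℝ (Fin 3)) :=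
    fun k => l k ^ 2 • stPull (l k ^ 2) (l k) (z k).1 (z k).2 H with hGzdef
  have hvz : ∀ k, zoom U (x k) 0 (l k) = v k := fun k => by
    simp only [hvdef, zoom_eq_smul_stPull, hz1, hz2]
  -- the class on every `Q(0, 2ᵐ)`
  have hballs : ∀ m k : ℕ, IsSuitableWeakSolutionInBall ((2 : ℝ) ^ m) 0 (v k) (q k) := by
    intro m k
    set ρ : ℝ := (2 : ℝ) ^ m * l k with hρ
    have hρ0 : 0 < ρ := mul_pos (hcc_pos m) (hl k)
    have hsub : parabolicCylinder ρ (z k) ⊆ parabolicCylinder (‖x k‖ + ρ) (0 : ℝ × (EuclideanSpace ℝ (Fin 3))) :=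
      parabolicCylinder_subset_zero (pow_le_pow_left₀ hρ0.le (by linarith [norm_nonneg (x k)]) 2)
        le_rfl
    have h0 : IsSuitableWeakSolutionInBall ρ (z k) U P :=
      (hIB (‖x k‖ + ρ) (by positivity)).of_subset_zero (z := z k) hρ0 hsub
    have h1 := h0.zoom hρ0
    set c : ℝ := l k / ρ with hc
    have hc0 : 0 < c := div_pos (hl k) hρ0
    have h2 := h1.zoomOut hc0
    have hcρ : c * ρ = l k := div_mul_cancel₀ _ hρ0.ne'
    have hrad : 1 / c = (2 : ℝ) ^ m := by
      rw [hc, one_div_div, hρ, mul_div_cancel_right₀ _ (hl k).ne']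
    rw [zoom_zoom, zoom_zoom, hcρ, hrad, show c ^ 2 * ρ ^ 2 = l k ^ 2 by rw [← hcρ]; ring] at h2
    exact h2
  -- the weak gradients
  have hgrads : ∀ m k : ℕ,
      HasWeakSpatialGradientOn (parabolicCylinderOpens ((2 : ℝ) ^ m) (0 : ℝ × (EuclideanSpace ℝ (Fin 3)))) (v k) (Gz k) := by
    intro m k
    set ρ : ℝ := (2 : ℝ) ^ m * l k with hρ
    have hρL : ρ / l k = (2 : ℝ) ^ m := by rw [hρ, mul_div_cancel_right₀ _ (hl k).ne']
    have h1 := (hH.mono (hQsl k ρ)).stRescale (l k) (β := l k ^ 2) (γ := l k) (pow_pos (hl k) 2)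
      (hl k) (z k).1 (z k).2
    have hpre : stPreimage (l k ^ 2) (l k) (z k).1 (z k).2 (parabolicCylinderOpens ρ (z k)) =
        parabolicCylinderOpens ((2 : ℝ) ^ m) (0 : ℝ × (EuclideanSpace ℝ (Fin 3))) := by
      refine TopologicalSpace.Opens.ext ?_
      have e := zoom_preimage_parabolicCylinder (hl k) (z k) ρ
      rw [hρL] at e
      exact e
    rw [show l k * l k = l k ^ 2 by ring, hpre] at h1
    exact h1
  -- the Type I bound
  have hIs : ∀ m k : ℕ,
      typeIBound (parabolicCylinder ((2 : ℝ) ^ m) (0 : ℝ × (EuclideanSpace ℝ (Fin 3)))) (v k) (q k) (Gz k) ≤ I₀ := by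
    intro m k
    set ρ : ℝ := (2 : ℝ) ^ m * l k with hρ
    have hρL : ρ / l k = (2 : ℝ) ^ m := by rw [hρ, mul_div_cancel_right₀ _ (hl k).ne']
    refine le_trans ?_ (typeIBound_mono (hzsub k ρ))
    rw [← typeIBound_nsZoom (hl k) (z k).1 (z k).2 (parabolicCylinder ρ (z k)) U P H,
      zoom_preimage_parabolicCylinder (hl k) (z k) ρ, hρL]
  -- ## compactness with the class on all balls (tree)
  obtain ⟨Ut, Pt, Ht, σ, hσ, hIBU, hswU, hHU, h4I, hmemU, hconvU, hpers⟩ :=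
    Summit.NavierStokesRegularity.NavierStokesRegularity.Cruxes.ScarEnvelopeTypeI.SliceBudget.local_typeI_compactness_twin_inBall
      I₀ v q Gz hI (fun m k _ => hballs m k) (fun m k _ => hgrads m k) (fun m k _ => hIs m k)
  have h4Itop : typeIBound (Iio (0 : ℝ) ×ˢ univ) Ut Pt Ht < ⊤ :=
    lt_of_le_of_lt h4I (ENNReal.mul_lt_top (by simp) hI)
  -- ## the rate: on the zooms everywhere, on the limit a.e.
  have hratev : ∀ (k : ℕ) (s : ℝ) (y : (EuclideanSpace ℝ (Fin 3))), s < 0 → ‖v k s y‖ ≤ M / Real.sqrt (-s) := by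
    intro k s y hs
    have hL2 : 0 < l k ^ 2 := pow_pos (hl k) 2
    have hL2s : l k ^ 2 * s < 0 := mul_neg_of_pos_of_neg hL2 hs
    have h := hdec _ hL2s (x k + l k • y)
    have hsq : Real.sqrt (-(l k ^ 2 * s)) = l k * Real.sqrt (-s) := by
      rw [show -(l k ^ 2 * s) = l k ^ 2 * (-s) by ring, Real.sqrt_mul (sq_nonneg _),
        Real.sqrt_sq (hl k).le]
    rw [hsq] at h
    have hspos : 0 < Real.sqrt (-s) := Real.sqrt_pos.2 (by linarith)
    show ‖(l k • stPull (l k ^ 2) (l k) (z k).1 (z k).2 U) s y‖ ≤ M / Real.sqrt (-s)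
    rw [smul_stPull_apply, hz1, hz2, zero_add, norm_smul, Real.norm_of_nonneg (hl k).le,
      le_div_iff₀ hspos]
    have h' := (le_div_iff₀ (mul_pos (hl k) hspos)).1 h
    calc l k * ‖U (l k ^ 2 * s) (x k + l k • y)‖ * Real.sqrt (-s)
        = ‖U (l k ^ 2 * s) (x k + l k • y)‖ * (l k * Real.sqrt (-s)) := by ring
      _ ≤ M := h'
  have hrate_ae : ∀ᵐ w ∂(volume.restrict (Iio (0 : ℝ) ×ˢ (univ : Set (EuclideanSpace ℝ (Fin 3))))),
      ‖Ut w.1 w.2‖ ≤ M / Real.sqrt (-w.1) := by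
    have hQ : ∀ m : ℕ, ∀ᵐ w ∂(volume.restrict (parabolicCylinder ((2 : ℝ) ^ m) (0 : ℝ × (EuclideanSpace ℝ (Fin 3))))),
        ‖Ut w.1 w.2‖ ≤ M / Real.sqrt (-w.1) := by
      intro m
      have hmeas : ∀ j, AEStronglyMeasurable (Function.uncurry (v (σ j)))
          (volume.restrict (parabolicCylinder ((2 : ℝ) ^ m) (0 : ℝ × (EuclideanSpace ℝ (Fin 3))))) := fun j =>
        (hballs m (σ j)).1.distributional.1.aestronglyMeasurable
      obtain ⟨ψ, -, hae⟩ := exists_subseq_tendsto_ae₃ hmeas (hmemU _ (hcc_pos m)).1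
        (hconvU _ (hcc_pos m))
      filter_upwards [hae, ae_restrict_mem (isOpen_parabolicCylinder _ _).measurableSet]
        with w hw hwmem
      refine le_of_tendsto hw.norm (Eventually.of_forall fun i => ?_)
      have hw0 : w.1 < 0 := by
        have h1 := ((mem_parabolicCylinder).1 hwmem).1.2
        simpa using h1
      exact hratev _ w.1 w.2 hw0
    have hcover : (Iio (0 : ℝ) ×ˢ (univ : Set (EuclideanSpace ℝ (Fin 3)))) ⊆
        ⋃ m : ℕ, parabolicCylinder ((2 : ℝ) ^ m) (0 : ℝ × (EuclideanSpace ℝ (Fin 3))) := by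
      rintro ⟨t, x'⟩ ⟨ht', -⟩
      obtain ⟨m, hm⟩ := exists_mem_parabolicCylinder_two_pow₃ (mem_Iio.1 ht') x'
      exact mem_iUnion.2 ⟨m, hm⟩
    exact ae_restrict_of_ae_restrict_of_subset hcover ((ae_restrict_iUnion_iff _ _).2 hQ)
  -- ## representatives: the rate everywhere, then continuous Oseen-mild (KNSS)
  obtain ⟨U₁, hae₁, hdec₁⟩ := exists_repr_hasTypeITimeDecay hM hrate_ae
  have hae₁' : ∀ᵐ w ∂(volume.restrict ((slab (EuclideanSpace ℝ (Fin 3)) (Iio 0) isOpen_Iio :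
      TopologicalSpace.Opens (ℝ × (EuclideanSpace ℝ (Fin 3)))) : Set (ℝ × (EuclideanSpace ℝ (Fin 3))))),
      Function.uncurry Ut w = Function.uncurry U₁ w := by
    rw [coe_slab]
    exact hae₁
  have hsw₁ : IsSuitableWeakSolutionOn (slab (EuclideanSpace ℝ (Fin 3)) (Iio 0) isOpen_Iio) 1 0 U₁ Pt :=
    hswU.congr_ae hae₁' (ae_of_all _ fun _ => rfl)
  have hI₁ : typeIBound (Iio (0 : ℝ) ×ˢ univ) U₁ Pt Ht < ⊤ := by
    rwa [← typeIBound_congr_ae hae₁]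
  obtain ⟨U', hae₂, hUc, hUdiv, hUmild, hUrate⟩ :=
    exists_oseenMild_repr_of_typeIBound_lt_top hsw₁ hdec₁ hI₁
  have hae : ∀ᵐ w ∂(volume.restrict (Iio (0 : ℝ) ×ˢ (univ : Set (EuclideanSpace ℝ (Fin 3))))),
      Function.uncurry Ut w = Function.uncurry U' w := by
    filter_upwards [hae₁, hae₂] with w h1 h2
    rw [h1, h2]
  have hae' : ∀ᵐ w ∂(volume.restrict ((slab (EuclideanSpace ℝ (Fin 3)) (Iio 0) isOpen_Iio :
      TopologicalSpace.Opens (ℝ × (EuclideanSpace ℝ (Fin 3)))) : Set (ℝ × (EuclideanSpace ℝ (Fin 3))))),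
      Function.uncurry Ut w = Function.uncurry U' w := by
    rw [coe_slab]
    exact hae
  have hTI : IsTypeIAncientMild M U' :=
    LocalTypeIBlowup.isTypeIAncientMild_of_continuous_oseenMild_rate hUc hUdiv hUmild hUrate
  have hIBU' : ∀ a : ℝ, 0 < a → IsSuitableWeakSolutionInBall a (0 : ℝ × (EuclideanSpace ℝ (Fin 3))) U' Pt := fun a ha =>
    (hIBU a ha).congr_ae'
      (ae_restrict_of_ae_restrict_of_subset (parabolicCylinder_origin_subset_slab a) hae)
      (ae_of_all _ fun _ => rfl)
  have hHU' : HasWeakSpatialGradientOn (slab (EuclideanSpace ℝ (Fin 3)) (Iio 0) isOpen_Iio) U' Ht :=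
    hHU.congr_ae hae'
  have hIeq : typeIBound (Iio (0 : ℝ) ×ˢ univ) U' Pt Ht = typeIBound (Iio (0 : ℝ) ×ˢ univ) Ut Pt Ht := by
    rw [← typeIBound_congr_ae hae]
  have hIU' : typeIBound (Iio (0 : ℝ) ×ˢ univ) U' Pt Ht < ⊤ := by
    rw [hIeq]
    exact h4Itop
  refine ⟨U', Pt, Ht, σ, hσ, ⟨hTI, hIBU', hHU', hIU'⟩, ?_, fun R hR => ?_, fun R hR => ?_,
    fun y hy => ?_⟩
  · -- `𝐈(U') ≤ 4 𝐈(U)`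
    rw [hIeq]
    exact h4I
  · -- `U' ∈ L³(Q_R(0))` for every `R > 0`
    exact (hmemU R hR).ae_eq
      (ae_restrict_of_ae_restrict_of_subset (parabolicCylinder_origin_subset_slab R) hae)
  · -- whole-space `L³_loc` convergence of the zooms along `σ` to `U'`
    have haeR : ∀ᵐ w ∂(volume.restrict (parabolicCylinder R (0 : ℝ × (EuclideanSpace ℝ (Fin 3))))),
        Function.uncurry Ut w = Function.uncurry U' w :=
      ae_restrict_of_ae_restrict_of_subset (parabolicCylinder_origin_subset_slab R) hae
    refine (hconvU R hR).congr' (Eventually.of_forall fun j => ?_)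
    beta_reduce
    rw [hvz]
    exact eLpNorm_congr_ae (haeR.mono fun w hw => by simp only [Pi.sub_apply, hw])
  · -- persistence of frequently-singular final-time points
    set zy : ℝ × (EuclideanSpace ℝ (Fin 3)) := ((0 : ℝ), y) with hzydef
    have hlimsup : ∀ R ∈ Ioo (0 : ℝ) 1, limsup (fun j => eLpNorm (Function.uncurry (v (σ j))) ⊤
        (volume.restrict (parabolicCylinder R zy))) atTop = ⊤ := by
      intro R hR
      refine top_le_iff.1 (le_limsup_of_frequently_le ?_)
      refine hy.mono fun j hj => ?_
      rw [hvz] at hj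
      exact (eLpNorm_top_eq_top_of_not_regPt hj hR.1).ge
    have hsing : IsBackwardSingularPoint Ut zy := hpers zy (by rw [hzydef]) hlimsup
    have h1 : ¬ RegPt Ut y := not_regPt_of_isBackwardSingularPoint hsing
    rintro ⟨r, hr, M', hM'⟩
    apply h1
    refine ⟨r, hr, M', ?_⟩
    have haer : ∀ᵐ w ∂(volume.restrict (parabolicCylinder r (((0 : ℝ), y) : ℝ × (EuclideanSpace ℝ (Fin 3))))),
        Function.uncurry Ut w = Function.uncurry U' w :=
      ae_restrict_of_ae_restrict_of_subset (parabolicCylinder_subset_lowerHalf r y) hae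
    filter_upwards [hM', haer] with w hw hw'
    have e : Ut w.1 w.2 = U' w.1 w.2 := hw'
    rw [e]
    exact hw

/-- **Full-sequence gallery limits are A–B objects (free centres, free scales, ONE factor 4).**
If the whole sequence of zooms `zoom U (x j) 0 (l j)` of an A–B object of rate `M` converges in
`L³(Q_R(0))` for every `R > 0` to a field `W ∈ L³_loc` (closed past), then `W` agrees a.e. on every
`Q_R(0)` with an A–B object `(U', P', H')` of rate `M` with `𝐈(U') ≤ 4·𝐈(U)`, and every
final-time point at which the zooms are eventually singular is a singular point of `U'`. -/
theorem abTower_of_galleryLimit {M : ℝ}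
    {H : ℝ → (EuclideanSpace ℝ (Fin 3)) → (EuclideanSpace ℝ (Fin 3)) →L[ℝ] (EuclideanSpace ℝ (Fin 3))}
    (h : ABTower M U P H) (x : ℕ → (EuclideanSpace ℝ (Fin 3))) {l : ℕ → ℝ} (hl : ∀ k, 0 < l k)
    {W : ℝ → (EuclideanSpace ℝ (Fin 3)) → (EuclideanSpace ℝ (Fin 3))}
    (hWmem : ∀ R : ℝ, 0 < R → MemLp (Function.uncurry W) 3
      (volume.restrict (parabolicCylinder R (0 : ℝ × (EuclideanSpace ℝ (Fin 3))))))
    (hconv : ∀ R : ℝ, 0 < R → Tendsto (fun j => eLpNorm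
      (Function.uncurry (zoom U (x j) 0 (l j)) - Function.uncurry W) 3
      (volume.restrict (parabolicCylinder R (0 : ℝ × (EuclideanSpace ℝ (Fin 3)))))) atTop (𝓝 0)) :
    ∃ (U' : ℝ → (EuclideanSpace ℝ (Fin 3)) → (EuclideanSpace ℝ (Fin 3))) (P' : ℝ → (EuclideanSpace ℝ (Fin 3)) → ℝ)
      (H' : ℝ → (EuclideanSpace ℝ (Fin 3)) → (EuclideanSpace ℝ (Fin 3)) →L[ℝ] (EuclideanSpace ℝ (Fin 3))),
      ABTower M U' P' H' ∧
      typeIBound (Iio (0 : ℝ) ×ˢ univ) U' P' H' ≤ 4 * typeIBound (Iio (0 : ℝ) ×ˢ univ) U P H ∧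
      (∀ R : ℝ, 0 < R → ∀ᵐ z ∂(volume.restrict (parabolicCylinder R (0 : ℝ × (EuclideanSpace ℝ (Fin 3))))),
        W z.1 z.2 = U' z.1 z.2) ∧
      (∀ y : (EuclideanSpace ℝ (Fin 3)),
        (∀ᶠ j in atTop, ¬ RegPt (zoom U (x j) 0 (l j)) y) → ¬ RegPt U' y) := by
  obtain ⟨U', P', H', σ, hσ, hAB, h4I, hmem, hconv', hpers⟩ := abTower_galleryCompact h x hl
  refine ⟨U', P', H', hAB, h4I, fun R hR => ?_, fun y hy => ?_⟩
  · have hmeasv : ∀ j, AEStronglyMeasurable (Function.uncurry (zoom U (x (σ j)) 0 (l (σ j))))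
        (volume.restrict (parabolicCylinder R (0 : ℝ × (EuclideanSpace ℝ (Fin 3))))) := fun j =>
      aestronglyMeasurable_zoom_of_inBall h.2.1 _ (hl _) hR
    have h1 : Tendsto (fun j => eLpNorm
        (Function.uncurry (zoom U (x (σ j)) 0 (l (σ j))) - Function.uncurry W) 3
        (volume.restrict (parabolicCylinder R (0 : ℝ × (EuclideanSpace ℝ (Fin 3)))))) atTop (𝓝 0) :=
      (hconv R hR).comp hσ.tendsto_atTop
    have hae := ae_eq_of_tendsto_eLpNorm_three hmeasv (hWmem R hR).1 (hmem R hR).1 h1 (hconv' R hR)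
    filter_upwards [hae] with z hz
    exact hz
  · exact hpers y ((hσ.tendsto_atTop.eventually hy).frequently)

end Gallery

end Summit.NavierStokesRegularity.NavierStokesRegularity.Cruxes.ScarEnvelopeTypeI.ZoomDictionary
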